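import Summits.ValiantsHypothesis.Statement
import Literature.Computability.AlgebraicComplexity.ValiantBooleanBridge
import Literature.NumberTheory.LFunctions.DedekindZeta
import Literature.Computability.Complexity.ClayProblem

/-!
# ValiantsHypothesis / BoolTransfer — assembly

Route `ValiantsHypothesis/BoolTransfer`, item `stmt-ValiantsHypothesis-0344` (rank 1, assembly):
Bürgisser's transfer theorem (Bürgisser 2000, Thm. 4.5 and Cor. 4.6(1); the named fact
`Literature.PNP.PPoly_eq_polyAdvice_NP_of_VP_eq_VNP ℂ`: `VP_ℂ = VNP_ℂ` and the Dedekind ERH give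
`P/poly = NP/poly`), together with the routine inclusion `NP ⊆ NP/poly` (kept as a hypothesis),
turn the route thesis `ERH ∧ NP ⊄ P/poly` into Valiant's hypothesis `VP_ℂ ≠ VNP_ℂ`.
Pure bookkeeping.
-/

namespace Literature.PNP

/-- Settles `stmt-ValiantsHypothesis-0344` (assembly of route `BoolTransfer`): if the Dedekind
ERH holds and `NP ⊄ P/poly`, then Bürgisser's collapse `VP_ℂ = VNP_ℂ ∧ ERH ⇒ P/poly = NP/poly`
(Bürgisser 2000, Cor. 4.6(1)) and `NP ⊆ NP/poly` give `ValiantsHypothesis` (`VP ℂ ≠ VNP ℂ`):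
from `VP ℂ = VNP ℂ` we would get `NP ⊆ NP/poly = P/poly`. [folklore] -/
theorem erh_and_npNotSubsetPPoly_imp_valiantsHypothesis :
    Literature.NumberTheory.LFunctions.ExtendedRiemannHypothesis ∧ Literature.Computability.Complexity.NPNotSubsetPPoly →
      Literature.Computability.AlgebraicComplexity.PPoly_eq_polyAdvice_NP_of_VP_eq_VNP ℂ →
        Literature.Computability.Complexity.Nondeterministic.NP ⊆ Literature.Computability.Complexity.polyAdvice Literature.Computability.Complexity.Nondeterministic.NP → ValiantsHypothesis := by
  rintro ⟨hERH, hX⟩ hB hNP hV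
  apply hX
  intro L hL
  have hEq : Literature.Computability.Complexity.PPoly = Literature.Computability.Complexity.polyAdvice Literature.Computability.Complexity.Nondeterministic.NP := hB hERH hV
  rw [hEq]
  exact hNP hL

end Literature.PNP
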